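import Summits.ValiantsHypothesis.ValiantsHypothesis.Theorems.KPlusLogSqLawTropicalBSplitGlue

/-!
# Route «KPlusLogSqLaw», crux `TropicalB` (stmt-ValiantsHypothesis-19771) — restricted optima of a design on a column set:
# DEFINITIONS of the Gusfield divide-and-conquer toolkit

HONEST FRAMING.  Definitions-only companion of `KPlusLogSqLawTropicalBIntervalOpt.lean` (the lemmas) and
`KPlusLogSqLawTropicalBHessenberg.lean` (the HESSENBERG sector theorem of `TropicalB`, desk docket D1(b) «first TropicalB rung
beyond slope counting»; seat val-sym-trop-p5).  Helper objects toward the registered stubs `stub_tropThin` / `stub_tropFat` of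
`Cruxes/TropicalB/Lines/birth.lean` (item stmt-ValiantsHypothesis-19771, route KPlusLogSqLaw, DRAFT).  Every `def` below is a
proof-internal object or a predicate WITH parameters (no `Prop` fact, nothing cited, nothing asserted); nothing here bears on
`TropicalB`, `KPlusLogSqLaw`, `MatrixDescartes` (stmt-ValiantsHypothesis-18050) or VP ≠ VNP.

For a tropical design `(d, v, ε)` of format `(m, K)`, a column set `J ⊆ Fin m` and a Leibniz term `p = (σ, λ)`:
* `IntervalOpt.sl d J p = Σ_{i∈J} d (λ i)`, `IntervalOpt.cst v J p = Σ_{i∈J} v (σ i) i (λ i)`,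
  `IntervalOpt.inW d v J θ p = θ·sl − cst` — the part of `tropWeight` carried by the columns of `J`;
* `IntervalOpt.restr J p : Fin m → Option (Fin m × Fin K)` — the data of `p` on `J`; `IntervalOpt.AgreeOut J p p'` — equality
  off `J`;
* `IntervalOpt.InOpt d v ε J θ p` — RESTRICTED unique optimum: `p` is present and strictly beats on `J`, at the integer slope
  `θ`, every other present term agreeing with it off `J` (Gusfield's sub-problem optimality);
* `IntervalOpt.optRestr d v ε J Q` — the finite set of restrictions to `J` of the terms satisfying `Q` that are restricted
  optima on `J` at some integer slope; `IntervalOpt.slr d J r` — the `J`-slope read off a restriction `r`;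
* `IntervalOpt.ico m a c` — the column interval `[a, c)`; `IntervalOpt.Stable J p` — `J` is a union of cycles of the
  permutation of `p`; `IntervalOpt.IsBlock x y p` — the permutation of `p` is the consecutive cycle `x → x+1 → ⋯ → y → x` on
  `[x, y]` (a block of a Hessenberg term).
[folklore] (D. Gusfield, Sensitivity analysis for combinatorial optimization, PhD thesis, UC Berkeley 1980 — the
`n^{O(log n)}` bound for parametric shortest paths; P. Carstensen, Math. Programming 26 (1983) 64–75.)
-/

set_option linter.dupNamespace false
set_option autoImplicit false

namespace Summit.ValiantsHypothesis.ValiantsHypothesis.Theorems.KPlusLogSqLaw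

open Summit.ValiantsHypothesis.ValiantsHypothesis.Theorems.MatrixDescartes.Negative
open scoped BigOperators
open Finset

namespace IntervalOpt

variable {m K : ℕ} (d : Fin K → ℕ) (v ε : Fin m → Fin m → Fin K → ℤ)

/-- `J`-slope of a term: `Σ_{i ∈ J} d (λ i)`. [folklore] -/
def sl (J : Finset (Fin m)) (p : Equiv.Perm (Fin m) × (Fin m → Fin K)) : ℤ := ∑ i ∈ J, (d (p.2 i) : ℤ)

/-- `J`-valuation of a term: `Σ_{i ∈ J} v (σ i) i (λ i)`. [folklore] -/
def cst (J : Finset (Fin m)) (p : Equiv.Perm (Fin m) × (Fin m → Fin K)) : ℤ := ∑ i ∈ J, v (p.1 i) i (p.2 i)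

/-- the part of the tropical weight carried by the columns of `J`. [folklore] -/
def inW (J : Finset (Fin m)) (θ : ℤ) (p : Equiv.Perm (Fin m) × (Fin m → Fin K)) : ℤ := θ * sl d J p - cst v J p

/-- the data of a term on the columns of `J`. [folklore] -/
def restr (J : Finset (Fin m)) (p : Equiv.Perm (Fin m) × (Fin m → Fin K)) : Fin m → Option (Fin m × Fin K) :=
  fun i => if i ∈ J then some (p.1 i, p.2 i) else none

/-- two terms agree OFF `J`. [folklore] -/
def AgreeOut (J : Finset (Fin m)) (p p' : Equiv.Perm (Fin m) × (Fin m → Fin K)) : Prop :=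
  ∀ i, i ∉ J → p.1 i = p'.1 i ∧ p.2 i = p'.2 i

/-- RESTRICTED unique optimum: `p` is present and strictly beats on `J`, at the integer slope `θ`, every other present term
that agrees with it off `J`. [folklore] -/
def InOpt (J : Finset (Fin m)) (θ : ℤ) (p : Equiv.Perm (Fin m) × (Fin m → Fin K)) : Prop :=
  termSign ε p ≠ 0 ∧ ∀ p', p' ≠ p → termSign ε p' ≠ 0 → AgreeOut J p p' → inW d v J θ p' < inW d v J θ p

open Classical in
/-- the restrictions to `J` of the terms satisfying `Q` that are restricted optima on `J` at some integer slope. [folklore] -/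
noncomputable def optRestr (J : Finset (Fin m)) (Q : Equiv.Perm (Fin m) × (Fin m → Fin K) → Prop) :
    Finset (Fin m → Option (Fin m × Fin K)) :=
  Finset.univ.filter fun r => ∃ p θ, Q p ∧ InOpt d v ε J θ p ∧ restr J p = r

/-- slope read off a restriction: `Σ_{i ∈ J} d (class stored at i)`. [folklore] -/
def slr (J : Finset (Fin m)) (r : Fin m → Option (Fin m × Fin K)) : ℤ :=
  ∑ i ∈ J, (r i).elim 0 fun q => (d q.2 : ℤ)


/-- the column interval `[a, c)` of `Fin m`. [folklore] -/
def ico (m a c : ℕ) : Finset (Fin m) := Finset.univ.filter fun i : Fin m => a ≤ (i : ℕ) ∧ (i : ℕ) < c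

/-- the column set `J` is stable under the permutation of the term `p` (`J` is a union of its cycles). [folklore] -/
def Stable (J : Finset (Fin m)) (p : Equiv.Perm (Fin m) × (Fin m → Fin K)) : Prop := ∀ i, i ∈ J ↔ p.1 i ∈ J

/-- the permutation of `p` is the consecutive cycle `x → x+1 → ⋯ → y → x` on the columns `x ≤ i ≤ y`
(a BLOCK of a Hessenberg term: subdiagonal entries `(i+1, i)` for `x ≤ i < y` and the corner entry `(x, y)`). [folklore] -/
def IsBlock (x y : ℕ) (p : Equiv.Perm (Fin m) × (Fin m → Fin K)) : Prop :=
  (∀ i : Fin m, x ≤ (i : ℕ) → (i : ℕ) < y → ((p.1 i : Fin m) : ℕ) = (i : ℕ) + 1) ∧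
  (∀ i : Fin m, (i : ℕ) = y → ((p.1 i : Fin m) : ℕ) = x)

end IntervalOpt

end Summit.ValiantsHypothesis.ValiantsHypothesis.Theorems.KPlusLogSqLaw
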